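import Mathlib.Algebra.Field.ZMod
import Summits.ABC.IUTFork.LanaLogLinkLifting
import HarnessLib

/-!
# L-LANA objects IX quater: `UniqueLifting` is satisfiable AND refutable over honest reference data (vacuity audit)

Vacuity-audit companion (D-0012; seat abc-iut-c312-4, L-LANA level) of `LanaLogTheta.lean` (gen 0: the
model-relative HYPOTHESIS `UniqueLifting ref`, LANA §5.3 (a) p. 29 / [IUTchI] Cor. 5.3 (ii)) and of
`LanaLogLinkLifting.lean` (this seat: `UniqueLifting ref ⟺ (∀ v, LiftExists (ref v)) ∧ (∀ v, LiftUnique (ref v))`);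
TAKES NO SIDE on [IUTchIII] Cor. 3.12. In the style of L5-t4's `isomFtoDBijective_toy` /
`exists_fkit_not_isomFtoDBijective` (`FPrimeStripsRigidity.lean`, [IUTchI] Cor. 5.3 (ii) over the Frobenioid kits):

* `RefLocalDatum.discrete K` — an HONEST inhabitant of the input interface `RefLocalDatum` for every field `K`
  (decidable equality): `K̄_v := K` with the discrete topology and the TRIVIAL valuation (Mathlib
  `(1 : Valuation K ℝ≥0)`: `|0| = 0`, `|a| = 1` otherwise), `G_v := Π_v := 1` (trivial groups, trivial action,
  `Π_v ↠ G_v` the identity); so `O^▷_v = K ∖ {0}`;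
* **`uniqueLifting_discrete_zmod_two` — `UniqueLifting` HOLDS** for the (one-place) reference family over
  `K = 𝔽₂`: there `O^▷ = {1}`, every automorphism of the GM-data `F_v` is the identity (CONSISTENCY: the
  hypothesis is satisfiable by genuine data, not only by `sorry`);
* **`not_uniqueLifting_discrete_rat` — `UniqueLifting` FAILS** for the reference family over `K = ℚ` (trivial
  valuation): inversion `a ↦ a⁻¹` of `O^▷ = ℚ^×` is a non-identity automorphism of `F_v` over the identity of
  `Π_v = 1` (`LiftUnique` fails; INDEPENDENCE: the hypothesis is NOT a consequence of the interface axioms — its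
  content is the rigidity [AbsTopIII] Prop. 3.2 (iv) attributes to the GALOIS action, which is absent here).

Together with `LanaLogLinkLiftingChecks.lean` (at the `ℚ_p` datum the uniqueness half follows from
`PairIsoDeterminedByGalois` alone) this completes the audit of the N12 hypothesis: satisfiable, refutable, and
reduced to a named published fact on genuine data. [cite: LANA2026Report, §5.3 (a) p. 29, Rem. 8.2.1 p. 42]
NOT here: any judgement.
-/

noncomputable section

namespace Summit.ABC
namespace IUTFork

open scoped NNReal

/-! ## 1. Discrete reference data with trivial valuation and trivial groups -/

namespace RefLocalDatum

variable (K : Type) [Field K] [DecidableEq K]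

/-- The trivial action of the trivial group on `K` by ring automorphisms. [folklore] -/
@[reducible] def trivialSemiringAction : MulSemiringAction PUnit K where
  smul _ x := x
  one_smul _ := rfl
  mul_smul _ _ _ := rfl
  smul_zero _ := rfl
  smul_add _ _ _ := rfl
  smul_one _ := rfl
  smul_mul _ _ _ := rfl

/-- **An honest inhabitant of `RefLocalDatum` for every field**: `K` discrete with the trivial valuation,
`G_v = Π_v = 1`. (A typing witness; no arithmetic content.) [cite: LANA2026Report, §3.8 (a) pp. 20–21] -/
def discrete : RefLocalDatum :=
  letI : TopologicalSpace K := ⊥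
  haveI : DiscreteTopology K := discreteTopology_bot K
  letI : MulSemiringAction PUnit K := trivialSemiringAction K
  { K := K
    Γ₀ := ℝ≥0
    w := 1
    G := PUnit
    P := PUnit
    instContinuousMul := ⟨continuous_of_discreteTopology⟩
    instVal := ⟨fun _ _ => rfl⟩
    instContinuousSMul := ⟨continuous_of_discreteTopology⟩
    ρ := ContinuousMonoidHom.id PUnit
    ρ_surjective := Function.surjective_id }

/-- `O^▷` of the discrete datum is `K ∖ {0}`: membership is `a ≠ 0`. [cite: LANA2026Report, §0.4 (b) p. 8] -/
theorem mem_intMonoid_discrete_iff (a : K) : a ∈ intMonoid (discrete K).w ↔ a ≠ 0 := by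
  change 0 < (1 : Valuation K ℝ≥0) a ∧ (1 : Valuation K ℝ≥0) a ≤ 1 ↔ a ≠ 0
  rw [Valuation.one_apply_def]
  split_ifs with h
  · simp [h]
  · simp [h]

/-- In the discrete datum the (trivial) group acts trivially on `O^▷`. [folklore] -/
theorem discrete_smul (g : (discrete K).Fhol.G) (m : (discrete K).Fhol.M) : g • m = m := rfl

end RefLocalDatum

/-! ## 2. `UniqueLifting` HOLDS over `𝔽₂` (consistency) -/

section Two

/-- In `𝔽₂` any two non-zero elements are equal. [folklore] -/
theorem zmod_two_eq_of_ne_zero : ∀ x y : ZMod 2, x ≠ 0 → y ≠ 0 → x = y := by decide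

/-- Over `𝔽₂` the monoid `O^▷ = 𝔽₂ ∖ {0} = {1}` is trivial. [folklore] -/
theorem intMonoid_zmod_two_subsingleton : Subsingleton (RefLocalDatum.discrete (ZMod 2)).Fhol.M := by
  refine ⟨fun a b => Subtype.ext ?_⟩
  exact zmod_two_eq_of_ne_zero _ _ ((RefLocalDatum.mem_intMonoid_discrete_iff (ZMod 2) _).mp a.2)
    ((RefLocalDatum.mem_intMonoid_discrete_iff (ZMod 2) _).mp b.2)

/-- **`LiftUnique` holds over `𝔽₂`**: two automorphisms of `F_v = (1 ↷ {1})` with the same group component agree.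
[cite: LANA2026Report, §5.3 (a) p. 29] -/
theorem liftUnique_discrete_zmod_two : (RefLocalDatum.discrete (ZMod 2)).LiftUnique := by
  intro Φ Ψ hG
  haveI := intMonoid_zmod_two_subsingleton
  exact GMData.Iso.ext' hG (ContinuousMulEquiv.ext fun m => Subsingleton.elim _ _)

/-- **`LiftExists` holds over `𝔽₂`** (indeed for every discrete datum): the trivial group acts trivially, so any
automorphism `f` of `Π_v = 1` lifts with the identity on `O^▷`. [cite: LANA2026Report, §5.3 (a) p. 29] -/
theorem liftExists_discrete (K : Type) [Field K] [DecidableEq K] : (RefLocalDatum.discrete K).LiftExists :=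
  fun f => ⟨⟨f, ContinuousMulEquiv.refl _, fun _ _ => rfl⟩, rfl⟩

/-- **CONSISTENCY: `UniqueLifting` is SATISFIABLE by honest data** — it holds for the one-place reference family
over `𝔽₂`. [cite: LANA2026Report, §5.3 (a) p. 29] -/
theorem uniqueLifting_discrete_zmod_two : UniqueLifting (fun _ : Unit => RefLocalDatum.discrete (ZMod 2)) :=
  uniqueLifting_of_ref (fun _ => liftExists_discrete (ZMod 2)) (fun _ => liftUnique_discrete_zmod_two)

end Two

/-! ## 3. `UniqueLifting` FAILS over `ℚ` with the trivial valuation (independence) -/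

section Rat

/-- Inversion `a ↦ a⁻¹` on `O^▷ = ℚ ∖ {0}` of the discrete datum over `ℚ`, as a bi-continuous monoid
automorphism (commutative monoid; discrete topology). [folklore] -/
def invIso : ↥(intMonoid (RefLocalDatum.discrete ℚ).w) ≃ₜ* ↥(intMonoid (RefLocalDatum.discrete ℚ).w) :=
  haveI : DiscreteTopology (RefLocalDatum.discrete ℚ).K := discreteTopology_bot _
  { toFun := fun a => ⟨((a : (RefLocalDatum.discrete ℚ).K) : ℚ)⁻¹, (RefLocalDatum.mem_intMonoid_discrete_iff ℚ _).mpr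
      (inv_ne_zero ((RefLocalDatum.mem_intMonoid_discrete_iff ℚ _).mp a.2))⟩
    invFun := fun a => ⟨((a : (RefLocalDatum.discrete ℚ).K) : ℚ)⁻¹, (RefLocalDatum.mem_intMonoid_discrete_iff ℚ _).mpr
      (inv_ne_zero ((RefLocalDatum.mem_intMonoid_discrete_iff ℚ _).mp a.2))⟩
    left_inv := fun a => Subtype.ext (inv_inv ((a : (RefLocalDatum.discrete ℚ).K) : ℚ))
    right_inv := fun a => Subtype.ext (inv_inv ((a : (RefLocalDatum.discrete ℚ).K) : ℚ))
    map_mul' := fun a b =>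
      Subtype.ext (mul_inv ((a : (RefLocalDatum.discrete ℚ).K) : ℚ) ((b : (RefLocalDatum.discrete ℚ).K) : ℚ))
    continuous_toFun := continuous_of_discreteTopology
    continuous_invFun := continuous_of_discreteTopology }

/-- The automorphism of `F_v` over the identity of `Π_v = 1` given by inversion on `O^▷`.
[cite: LANA2026Report, Def. 3.7.1 p. 20] -/
def invGMIso : GMData.Iso (RefLocalDatum.discrete ℚ).Fhol (RefLocalDatum.discrete ℚ).Fhol where
  eG := ContinuousMulEquiv.refl _
  eM := invIso
  map_smul _ _ := rfl

/-- `2 ∈ O^▷ = ℚ ∖ {0}`. [folklore] -/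
def twoInt : (RefLocalDatum.discrete ℚ).Fhol.M :=
  ⟨(2 : ℚ), (RefLocalDatum.mem_intMonoid_discrete_iff ℚ _).mpr two_ne_zero⟩

/-- Inversion is not the identity: `2⁻¹ ≠ 2`. [folklore] -/
theorem invGMIso_ne_refl : invGMIso ≠ GMData.Iso.refl (RefLocalDatum.discrete ℚ).Fhol := by
  intro h
  have h2 := congrArg (fun Φ : GMData.Iso (RefLocalDatum.discrete ℚ).Fhol (RefLocalDatum.discrete ℚ).Fhol =>
    ((Subtype.val (Φ.eM twoInt) : (RefLocalDatum.discrete ℚ).K) : ℚ)) h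
  have h3 : (2 : ℚ)⁻¹ = 2 := h2
  norm_num at h3

/-- **`LiftUnique` fails over `ℚ` (trivial valuation)**: inversion and the identity are two automorphisms of
`F_v` over the same (identity) automorphism of `Π_v = 1`. [cite: LANA2026Report, §5.3 (a) p. 29] -/
theorem not_liftUnique_discrete_rat : ¬ (RefLocalDatum.discrete ℚ).LiftUnique :=
  fun h => invGMIso_ne_refl (h invGMIso (GMData.Iso.refl _) rfl)

/-- **INDEPENDENCE: `UniqueLifting` is REFUTABLE over honest data** — it fails for the one-place reference family
over `ℚ` with the trivial valuation and trivial groups: the hypothesis of `LanaLogTheta.lean` is not a consequence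
of the interface axioms; its content is rigidity supplied by the Galois action ([AbsTopIII] Prop. 3.2 (iv)), absent
here. [cite: LANA2026Report, §5.3 (a) p. 29] -/
theorem not_uniqueLifting_discrete_rat : ¬ UniqueLifting (fun _ : Unit => RefLocalDatum.discrete ℚ) :=
  fun h => not_liftUnique_discrete_rat (liftUnique_of_uniqueLifting h ())

end Rat

end IUTFork

end Summit.ABC

end
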